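import Mathlib
import Literature.Probability.LatticeModels.GKSInequalities
import Summits.CriticalPhenomena.Ising3DConformalLimit.Theses.PrecisionLaplacian
import HarnessLib

/-!
# Crux `PrecisionLaplacian.InverseMFerromagnet` (stmt-CriticalPhenomena-4798), line `Sketch` —
# stub `stub_im_of_pcm` (core chain, "PCM ⇒ IM")

THEOREM-ONLY file (no definitions).  PCM: in every spin system `gksExpect univ K C` with `K ≥ 0`
on supports of at most two sites, a linear observable `φ = ∑ c_w σ_w` with `Cov(φ, σ_z) ≥ 0` for
all `z` has `⟨φ⟩ ≥ 0`.  IM (the crux): for the zero-field pair ferromagnet (`|C i| = 2`) the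
second-moment matrix `Σ = (⟨σ_pσ_q⟩)` has `(Σ⁻¹)_{xy} ≤ 0` for `x ≠ y`.  We prove PCM ⇒ IM.
Freeze the spin `y` (same couplings on the supports `C_i ∖ {y}`: a pair through `y` becomes a
nonnegative field, so PCM applies); write `⟨·⟩'`, `m' = ⟨σ⟩'`, `Cov' = (⟨σ_pσ_q⟩' - m'_p m'_q)`.
Then `Σ_{zy} = m'_z`, `Σ_{zw} = ⟨σ_zσ_w⟩'` off `y` (on `{σ_y = 1}` the two weights agree, the spin
`y` is free in the frozen system, odd moments of the pair system vanish by the global flip),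
`m'_y = 0` and the row `y` of `Cov'` is `e_y`; `Cov'` is positive definite, `λ := Cov'⁻¹ m'` has
`λ_y = 0` and `λ_b ≥ 0` by PCM applied to the row `b` of `Cov'⁻¹`; finally
`g = (1 + m'·λ) e_y - λ` solves `Σ g = e_y`, so `(Σ⁻¹)_{xy} = g_x = -λ_x ≤ 0`.
-/

namespace Summit.CriticalPhenomena.Ising3DConformalLimit.Cruxes.InverseMFerromagnet.PartialCovarianceLadder

open Literature.Probability.LatticeModels Finset Matrix
open Summit.CriticalPhenomena.Ising3DConformalLimit.Theses.PrecisionLaplacian (InverseMFerromagnet)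

variable {n m : ℕ} (K : Fin m → ℝ) (C : Fin m → Finset (Fin n))

/-- `E[f + g] = E[f] + E[g]`. [folklore] -/
theorem pcm2im_gksExpect_add (f g : SpinConfig (Fin n) → ℝ) :
    gksExpect Finset.univ K C (fun ω => f ω + g ω)
      = gksExpect Finset.univ K C f + gksExpect Finset.univ K C g := by
  simp only [gksExpect, gksSum, add_mul, Finset.sum_add_distrib, add_div]

/-- `E[c f] = c E[f]`. [folklore] -/
theorem pcm2im_gksExpect_const_mul (c : ℝ) (f : SpinConfig (Fin n) → ℝ) :
    gksExpect Finset.univ K C (fun ω => c * f ω) = c * gksExpect Finset.univ K C f := by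
  simp only [gksExpect, gksSum, mul_assoc, ← Finset.mul_sum, mul_div_assoc]

/-- `E[a] = a`. [folklore] -/
theorem pcm2im_gksExpect_const (a : ℝ) : gksExpect Finset.univ K C (fun _ => a) = a := by
  have h := pcm2im_gksExpect_const_mul K C a (fun _ => 1)
  rw [mul_one] at h; rw [h, gksExpect, div_self (gksSum_one_pos Finset.univ K C).ne', mul_one]

/-- `E[∑_{a ∈ T} g_a] = ∑_{a ∈ T} E[g_a]`. [folklore] -/
theorem pcm2im_gksExpect_finset_sum {α : Type*} (T : Finset α) (g : α → SpinConfig (Fin n) → ℝ) :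
    gksExpect Finset.univ K C (fun ω => ∑ a ∈ T, g a ω)
      = ∑ a ∈ T, gksExpect Finset.univ K C (g a) := by
  unfold gksExpect gksSum
  rw [← Finset.sum_div]
  congr 1
  simp_rw [Finset.sum_mul]
  rw [Finset.sum_comm]

/-- `E[σ_z σ_z] = 1`. [folklore] -/
theorem pcm2im_gksExpect_sq (z : Fin n) :
    gksExpect Finset.univ K C (fun ω => spinAt z ω * spinAt z ω) = 1 := by
  simp_rw [spinAt_mul_self]
  exact pcm2im_gksExpect_const K C 1

/-- `⟨f⟩ > 0` for a nonnegative `f` that is positive somewhere. [folklore] -/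
theorem pcm2im_gksExpect_pos {f : SpinConfig (Fin n) → ℝ} (hf : ∀ ω, 0 ≤ f ω)
    (ω₀ : SpinConfig (Fin n)) (h0 : 0 < f ω₀) : 0 < gksExpect Finset.univ K C f :=
  div_pos (Finset.sum_pos' (fun ω _ => mul_nonneg (hf ω) (gksWeight_pos _ K C ω).le)
    ⟨ω₀, Finset.mem_univ _, mul_pos h0 (gksWeight_pos _ K C ω₀)⟩) (gksSum_one_pos _ K C)

/-- `σ_y` changes sign under the flip of the spin `y`. [folklore] -/
theorem pcm2im_spinAt_flip_same (y : Fin n) (ω : SpinConfig (Fin n)) :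
    spinAt y (ω * Pi.mulSingle y (-1)) = -spinAt y ω := by
  simp [spinAt, Pi.mulSingle_eq_same, Units.val_neg]

/-- `σ_w`, `w ≠ y`, is invariant under the flip of the spin `y`. [folklore] -/
theorem pcm2im_spinAt_flip_ne {w y : Fin n} (hwy : w ≠ y) (ω : SpinConfig (Fin n)) :
    spinAt w (ω * Pi.mulSingle y (-1)) = spinAt w ω := by
  simp [spinAt, Pi.mulSingle_eq_of_ne hwy]

/-- The weight frozen at `y` (supports `C_i ∖ {y}`) is invariant under the flip of `y`. [folklore] -/
theorem pcm2im_frozenWeight_flip (y : Fin n) (ω : SpinConfig (Fin n)) :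
    gksWeight Finset.univ K (fun i => C i \ {y}) (ω * Pi.mulSingle y (-1))
      = gksWeight Finset.univ K (fun i => C i \ {y}) ω := by
  simp only [gksWeight, gksHamiltonian, spinProduct]
  congr 1
  refine Finset.sum_congr rfl fun i _ => ?_
  congr 1
  refine Finset.prod_congr rfl fun x hx => pcm2im_spinAt_flip_ne ?_ ω
  have := (Finset.mem_sdiff.1 hx).2
  rwa [Finset.mem_singleton] at this

/-- The spin `y` is free in the system frozen at `y`: `∑ F σ_y w' = 0` for flip-invariant `F`. [folklore] -/
theorem pcm2im_frozen_sum_odd (y : Fin n) (F : SpinConfig (Fin n) → ℝ)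
    (hF : ∀ ω, F (ω * Pi.mulSingle y (-1)) = F ω) :
    gksSum Finset.univ K (fun i => C i \ {y}) (fun ω => F ω * spinAt y ω) = 0 := by
  simp only [gksSum]
  have h := Equiv.sum_comp (Equiv.mulRight (Pi.mulSingle y (-1) : SpinConfig (Fin n)))
    (fun ω => F ω * spinAt y ω * gksWeight Finset.univ K (fun i => C i \ {y}) ω)
  simp only [Equiv.coe_mulRight, hF, pcm2im_spinAt_flip_same, pcm2im_frozenWeight_flip K C y,
    mul_neg, neg_mul, Finset.sum_neg_distrib] at h
  linarith

/-- On every configuration `(1 + σ_y) w = (1 + σ_y) w'`, `w'` the weight frozen at `y`. [folklore] -/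
theorem pcm2im_weight_ind (y : Fin n) (ω : SpinConfig (Fin n)) :
    (1 + spinAt y ω) * gksWeight Finset.univ K C ω
      = (1 + spinAt y ω) * gksWeight Finset.univ K (fun i => C i \ {y}) ω := by
  rcases Int.units_eq_one_or (ω y) with h | h
  · congr 1
    simp only [gksWeight, gksHamiltonian]
    congr 1
    refine Finset.sum_congr rfl fun i _ => ?_
    congr 1
    simp only [spinProduct]
    by_cases hy : y ∈ C i
    · rw [Finset.sdiff_singleton_eq_erase, ← Finset.mul_prod_erase (C i) (fun x => spinAt x ω) hy]
      simp [spinAt, h]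
    · rw [Finset.sdiff_singleton_eq_erase, Finset.erase_eq_of_notMem hy]
  · have h0 : 1 + spinAt y ω = 0 := by simp [spinAt, h]
    rw [h0, zero_mul, zero_mul]

/-- **Key identity.** `∑ F w + ∑ F σ_y w = ∑ F w'` for `F` invariant under the flip of `y`. [folklore] -/
theorem pcm2im_sum_add_sum_mul (y : Fin n) (F : SpinConfig (Fin n) → ℝ)
    (hF : ∀ ω, F (ω * Pi.mulSingle y (-1)) = F ω) :
    gksSum Finset.univ K C F + gksSum Finset.univ K C (fun ω => F ω * spinAt y ω)
      = gksSum Finset.univ K (fun i => C i \ {y}) F := by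
  have h0 := pcm2im_frozen_sum_odd K C y F hF
  simp only [gksSum] at h0 ⊢
  rw [← add_zero (∑ ω, F ω * gksWeight Finset.univ K (fun i => C i \ {y}) ω), ← h0,
    ← Finset.sum_add_distrib, ← Finset.sum_add_distrib]
  exact Finset.sum_congr rfl fun ω _ => by linear_combination F ω * pcm2im_weight_ind K C y ω

/-- Odd observables have zero unnormalised mean in a zero-field pair system (`|C i| = 2`). [folklore] -/
theorem pcm2im_sum_odd (hC : ∀ i, (C i).card = 2) (f : SpinConfig (Fin n) → ℝ)
    (hf : ∀ ω, f (-ω) = -f ω) : gksSum Finset.univ K C f = 0 := by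
  have hw : ∀ ω : SpinConfig (Fin n), gksWeight Finset.univ K C (-ω) = gksWeight Finset.univ K C ω := by
    intro ω
    simp only [gksWeight, gksHamiltonian]
    congr 1
    refine Finset.sum_congr rfl fun i _ => ?_
    rw [spinProduct_neg, hC i]
    norm_num
  have h := Equiv.sum_comp (Equiv.neg (SpinConfig (Fin n))) (fun ω => f ω * gksWeight Finset.univ K C ω)
  simp only [Equiv.neg_apply, hf, hw, neg_mul, Finset.sum_neg_distrib] at h
  simp only [gksSum]
  linarith

/-- `Z' = Z`: freezing at `y` does not change the partition function of a pair system. [folklore] -/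
theorem pcm2im_Z_eq (hC : ∀ i, (C i).card = 2) (y : Fin n) :
    gksSum Finset.univ K (fun i => C i \ {y}) (fun _ => 1) = gksSum Finset.univ K C (fun _ => 1) := by
  have h := pcm2im_sum_add_sum_mul K C y (fun _ => 1) (fun _ => rfl)
  have h0 : gksSum Finset.univ K C (fun ω => 1 * spinAt y ω) = 0 :=
    pcm2im_sum_odd K C hC _ fun ω => by simp [spinAt, Units.val_neg]
  linarith

/-- `⟨σ_w σ_y⟩ = ⟨σ_w⟩'` for `w ≠ y` (`⟨·⟩'` = the system frozen at `y`). [folklore] -/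
theorem pcm2im_pair_eq_frozen_mag (hC : ∀ i, (C i).card = 2) {w y : Fin n} (hwy : w ≠ y) :
    gksExpect Finset.univ K C (fun ω => spinAt w ω * spinAt y ω)
      = gksExpect Finset.univ K (fun i => C i \ {y}) (spinAt w) := by
  have h := pcm2im_sum_add_sum_mul K C y (spinAt w) (pcm2im_spinAt_flip_ne hwy)
  have h0 : gksSum Finset.univ K C (spinAt w) = 0 :=
    pcm2im_sum_odd K C hC _ fun ω => by simp [spinAt, Units.val_neg]
  rw [h0, zero_add] at h
  simp only [gksExpect]
  rw [h, pcm2im_Z_eq K C hC y]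

/-- `⟨σ_z σ_w⟩ = ⟨σ_z σ_w⟩'` for `z, w ≠ y`. [folklore] -/
theorem pcm2im_pair_eq_frozen_pair (hC : ∀ i, (C i).card = 2) {z w y : Fin n} (hzy : z ≠ y)
    (hwy : w ≠ y) : gksExpect Finset.univ K C (fun ω => spinAt z ω * spinAt w ω)
      = gksExpect Finset.univ K (fun i => C i \ {y}) (fun ω => spinAt z ω * spinAt w ω) := by
  have h := pcm2im_sum_add_sum_mul K C y (fun ω => spinAt z ω * spinAt w ω) fun ω => by
    rw [pcm2im_spinAt_flip_ne hzy, pcm2im_spinAt_flip_ne hwy]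
  have h0 : gksSum Finset.univ K C (fun ω => spinAt z ω * spinAt w ω * spinAt y ω) = 0 :=
    pcm2im_sum_odd K C hC _ fun ω => by simp [spinAt, Units.val_neg]
  rw [h0, add_zero] at h
  simp only [gksExpect]
  rw [h, pcm2im_Z_eq K C hC y]

/-- `⟨σ_y⟩' = 0`: the spin `y` is free in the system frozen at `y`. [folklore] -/
theorem pcm2im_frozen_mag_y (y : Fin n) : gksExpect Finset.univ K (fun i => C i \ {y}) (spinAt y) = 0 := by
  have h := pcm2im_frozen_sum_odd K C y (fun _ => 1) (fun _ => rfl)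
  simp only [one_mul] at h
  simp only [gksExpect]
  rw [show (spinAt y : SpinConfig (Fin n) → ℝ) = fun ω => spinAt y ω from rfl, h, zero_div]

/-- `⟨σ_y σ_w⟩' = 0` for `w ≠ y`. [folklore] -/
theorem pcm2im_frozen_pair_y {w y : Fin n} (hwy : w ≠ y) :
    gksExpect Finset.univ K (fun i => C i \ {y}) (fun ω => spinAt y ω * spinAt w ω) = 0 := by
  have h := pcm2im_frozen_sum_odd K C y (spinAt w) (pcm2im_spinAt_flip_ne hwy)
  simp only [gksExpect]
  simp_rw [mul_comm (spinAt y _)]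
  rw [h, zero_div]

/-- `vᵀ (⟨φ_p φ_q⟩)_{p,q} v = ⟨(∑ v_p φ_p)²⟩`. [folklore] -/
theorem pcm2im_quadForm (φ : Fin n → SpinConfig (Fin n) → ℝ) (v : Fin n → ℝ) :
    v ⬝ᵥ ((Matrix.of fun p q : Fin n => gksExpect Finset.univ K C (fun ω => φ p ω * φ q ω)) *ᵥ v)
      = gksExpect Finset.univ K C (fun ω => (∑ p, v p * φ p ω) ^ 2) := by
  have hsq : (fun ω : SpinConfig (Fin n) => (∑ p, v p * φ p ω) ^ 2)
      = fun ω => ∑ p, ∑ q, (v p * v q) * (φ p ω * φ q ω) := by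
    funext ω
    rw [sq, Finset.sum_mul_sum]
    exact Finset.sum_congr rfl fun p _ => Finset.sum_congr rfl fun q _ => by ring
  rw [hsq, pcm2im_gksExpect_finset_sum]
  simp only [dotProduct, Matrix.mulVec, Matrix.of_apply]
  refine Finset.sum_congr rfl fun p _ => ?_
  rw [pcm2im_gksExpect_finset_sum, Finset.mul_sum]
  refine Finset.sum_congr rfl fun q _ => ?_
  rw [pcm2im_gksExpect_const_mul]
  ring

/-- `(⟨(σ_p - a_p)(σ_q - a_q)⟩)_{p,q}` is positive definite for any constants `a`: its quadratic
form is `⟨L²⟩`, `L = ∑ v_p (σ_p - a_p) ≢ 0` for `v ≠ 0` (flip one spin `p₀`, `v_{p₀} ≠ 0`). [folklore] -/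
theorem pcm2im_posDef_centred (a : Fin n → ℝ) : (Matrix.of fun p q : Fin n =>
      gksExpect Finset.univ K C (fun ω => (spinAt p ω - a p) * (spinAt q ω - a q))).PosDef := by
  rw [Matrix.posDef_iff_dotProduct_mulVec]
  refine ⟨?_, fun v hv => ?_⟩
  · refine Matrix.IsHermitian.ext fun p q => ?_
    simp only [Matrix.of_apply, star_trivial]
    exact congrArg _ (funext fun ω => mul_comm _ _)
  · simp only [star_trivial]
    rw [pcm2im_quadForm K C (fun p ω => spinAt p ω - a p) v]
    obtain ⟨p₀, hp₀⟩ : ∃ p, v p ≠ 0 := by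
      by_contra hall
      push Not at hall
      exact hv (funext hall)
    -- two configurations differing at `p₀`
    set ω₁ : SpinConfig (Fin n) := fun _ => 1 with hω₁
    set ω₂ : SpinConfig (Fin n) := Function.update ω₁ p₀ (-1) with hω₂
    have hdiff : (∑ p, v p * (spinAt p ω₁ - a p)) - (∑ p, v p * (spinAt p ω₂ - a p))
        = 2 * v p₀ := by
      rw [← Finset.sum_sub_distrib, Finset.sum_eq_single p₀ (fun p _ hp => ?_) (by simp)]
      · simp only [spinAt, hω₂, hω₁, Function.update_self, Units.val_neg, Units.val_one,
          Int.cast_neg, Int.cast_one]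
        ring
      · simp only [spinAt, hω₂, hω₁, Function.update_of_ne hp]
        ring
    by_cases h1 : ∑ p, v p * (spinAt p ω₁ - a p) = 0
    · refine pcm2im_gksExpect_pos K C (fun ω => sq_nonneg _) ω₂ ?_
      have h2 : ∑ p, v p * (spinAt p ω₂ - a p) = -(2 * v p₀) := by linarith
      rw [h2, neg_sq]
      exact sq_pos_of_ne_zero (mul_ne_zero two_ne_zero hp₀)
    · exact pcm2im_gksExpect_pos K C (fun ω => sq_nonneg _) ω₁ (sq_pos_of_ne_zero h1)

/-- `⟨(σ_p - m_p)(σ_q - m_q)⟩ = ⟨σ_pσ_q⟩ - m_p m_q` for `m = ⟨σ⟩`. [folklore] -/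
theorem pcm2im_centred_entry (p q : Fin n) :
    gksExpect Finset.univ K C (fun ω => (spinAt p ω - gksExpect Finset.univ K C (spinAt p))
        * (spinAt q ω - gksExpect Finset.univ K C (spinAt q)))
      = gksExpect Finset.univ K C (fun ω => spinAt p ω * spinAt q ω)
        - gksExpect Finset.univ K C (spinAt p) * gksExpect Finset.univ K C (spinAt q) := by
  have h : (fun ω => (spinAt p ω - gksExpect Finset.univ K C (spinAt p))
        * (spinAt q ω - gksExpect Finset.univ K C (spinAt q)))
      = fun ω => spinAt p ω * spinAt q ω + ((-gksExpect Finset.univ K C (spinAt q)) * spinAt p ω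
          + ((-gksExpect Finset.univ K C (spinAt p)) * spinAt q ω
            + gksExpect Finset.univ K C (spinAt p) * gksExpect Finset.univ K C (spinAt q))) := by
    funext ω
    ring
  rw [h, pcm2im_gksExpect_add, pcm2im_gksExpect_add, pcm2im_gksExpect_add,
    pcm2im_gksExpect_const_mul, pcm2im_gksExpect_const_mul, pcm2im_gksExpect_const]
  ring

/-- **The covariance matrix `(⟨σ_pσ_q⟩ - ⟨σ_p⟩⟨σ_q⟩)_{p,q}` is positive definite.** [folklore] -/
theorem pcm2im_cov_posDef :
    (Matrix.of fun p q : Fin n => gksExpect Finset.univ K C (fun ω => spinAt p ω * spinAt q ω)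
      - gksExpect Finset.univ K C (spinAt p) * gksExpect Finset.univ K C (spinAt q)).PosDef := by
  have h := pcm2im_posDef_centred K C (fun p => gksExpect Finset.univ K C (spinAt p))
  simp only [pcm2im_centred_entry] at h
  exact h

/-- **The second-moment matrix `(⟨σ_pσ_q⟩)_{p,q}` is positive definite.** [folklore] -/
theorem pcm2im_sigma_posDef : (Matrix.of fun p q : Fin n =>
      gksExpect Finset.univ K C (fun ω => spinAt p ω * spinAt q ω)).PosDef := by
  have h := pcm2im_posDef_centred K C (fun _ => 0)
  simp only [sub_zero] at h
  exact h

/-- If `Σ_yy = 1`, `Σ_zy = Σ_yz = m_z` and `Σ_zw = Cov_zw + m_z m_w` off `y`, `(Cov λ)_z = m_z` off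
`y` and `λ_y = 0`, then `Σ g = e_y` for `g_y = 1 + m·λ`, `g_w = -λ_w` (`w ≠ y`). [folklore] -/
theorem pcm2im_mulVec_eq_single (Sg Cv : Matrix (Fin n) (Fin n) ℝ) (mv lam : Fin n → ℝ)
    (y : Fin n) (hcol : ∀ z, z ≠ y → Sg z y = mv z) (hrow : ∀ w, w ≠ y → Sg y w = mv w)
    (hblk : ∀ z w, z ≠ y → w ≠ y → Sg z w = Cv z w + mv z * mv w) (hyy : Sg y y = 1)
    (hlam : ∀ z, z ≠ y → ∑ w, Cv z w * lam w = mv z) (hlamy : lam y = 0) :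
    Sg *ᵥ (fun w => if w = y then 1 + ∑ u, mv u * lam u else -lam w) = Pi.single y 1 := by
  funext z
  simp only [Matrix.mulVec, dotProduct]
  have hsplit := Finset.add_sum_erase Finset.univ
    (fun w => Sg z w * (if w = y then 1 + ∑ u, mv u * lam u else -lam w)) (Finset.mem_univ y)
  have herase : ∑ w ∈ Finset.univ.erase y, Sg z w * (if w = y then 1 + ∑ u, mv u * lam u else -lam w)
      = -∑ w ∈ Finset.univ.erase y, Sg z w * lam w := by
    rw [← Finset.sum_neg_distrib]
    refine Finset.sum_congr rfl fun w hw => ?_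
    rw [if_neg (Finset.ne_of_mem_erase hw)]
    ring
  rw [← hsplit, herase, if_pos rfl]
  by_cases hz : z = y
  · subst hz
    rw [hyy, Pi.single_eq_same, one_mul]
    have h1 : ∑ w ∈ Finset.univ.erase z, Sg z w * lam w = ∑ w ∈ Finset.univ.erase z, mv w * lam w :=
      Finset.sum_congr rfl fun w hw => by rw [hrow w (Finset.ne_of_mem_erase hw)]
    rw [h1, Finset.sum_erase_eq_sub (Finset.mem_univ _), hlamy]
    ring
  · rw [Pi.single_eq_of_ne hz, hcol z hz]
    have h1 : ∑ w ∈ Finset.univ.erase y, Sg z w * lam w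
        = ∑ w ∈ Finset.univ.erase y, (Cv z w + mv z * mv w) * lam w :=
      Finset.sum_congr rfl fun w hw => by rw [hblk z w hz (Finset.ne_of_mem_erase hw)]
    rw [h1, Finset.sum_erase_eq_sub (Finset.mem_univ _), hlamy]
    have h2 : ∑ w, (Cv z w + mv z * mv w) * lam w = mv z + mv z * ∑ u, mv u * lam u := by
      rw [← hlam z hz, Finset.mul_sum, ← Finset.sum_add_distrib]
      exact Finset.sum_congr rfl fun w _ => by ring
    rw [h2]
    ring

/-- For invertible `Σ`, `Σ g = e_y` identifies `g` as the column `y` of `Σ⁻¹`. [folklore] -/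
theorem pcm2im_inv_entry (Sg : Matrix (Fin n) (Fin n) ℝ) (hunit : IsUnit Sg.det) (g : Fin n → ℝ)
    (y : Fin n) (hg : Sg *ᵥ g = Pi.single y 1) (x : Fin n) : Sg⁻¹ x y = g x := by
  have h : Sg⁻¹ *ᵥ (Sg *ᵥ g) = g := by
    rw [Matrix.mulVec_mulVec, Matrix.nonsing_inv_mul _ hunit, Matrix.one_mulVec]
  rw [hg, Matrix.mulVec_single_one] at h
  have hx := congrFun h x
  rwa [Matrix.col_apply] at hx

/-- Registered stub `stub_im_of_pcm` (core chain of line `Sketch`, "PCM ⇒ IM"): if in every system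
with nonnegative couplings on supports of at most two sites a linear spin observable that is
nonnegatively correlated with every spin has nonnegative mean (PCM), then the zero-field pair
ferromagnet has `(Σ⁻¹)_{xy} ≤ 0` for `x ≠ y` (IM); see the module docstring. [folklore] -/
theorem stub_im_of_pcm : (∀ (n m : ℕ) (K : Fin m → ℝ) (C : Fin m → Finset (Fin n)), (∀ i, 0 ≤ K i) → (∀ i, (C i).card ≤ 2) → ∀ c : Fin n → ℝ, (∀ z : Fin n, 0 ≤ ∑ w, c w * (gksExpect Finset.univ K C (fun ω => spinAt w ω * spinAt z ω) - gksExpect Finset.univ K C (spinAt w) * gksExpect Finset.univ K C (spinAt z))) → 0 ≤ ∑ w, c w * gksExpect Finset.univ K C (spinAt w)) → InverseMFerromagnet := by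
  intro hPCM n m K C hK hC x y hxy
  -- the system frozen at `y`: supports `C' i = C i ∖ {y}`, same couplings
  obtain ⟨C', hC'⟩ : ∃ C' : Fin m → Finset (Fin n), C' = fun i => C i \ {y} := ⟨_, rfl⟩
  have hC'2 : ∀ i, (C' i).card ≤ 2 := fun i => by
    rw [hC']
    exact (Finset.card_le_card Finset.sdiff_subset).trans (hC i).le
  -- its magnetisations `mv`, covariance matrix `Cv`, and `lam = Cv⁻¹ mv`
  obtain ⟨mv, hmv⟩ : ∃ mv : Fin n → ℝ, mv = fun p => gksExpect Finset.univ K C' (spinAt p) := ⟨_, rfl⟩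
  obtain ⟨Cv, hCv⟩ : ∃ Cv : Matrix (Fin n) (Fin n) ℝ, Cv = Matrix.of fun p q : Fin n =>
      gksExpect Finset.univ K C' (fun ω => spinAt p ω * spinAt q ω)
        - gksExpect Finset.univ K C' (spinAt p) * gksExpect Finset.univ K C' (spinAt q) :=
    ⟨_, rfl⟩
  have hCv_apply : ∀ p q, Cv p q
      = gksExpect Finset.univ K C' (fun ω => spinAt p ω * spinAt q ω) - mv p * mv q := fun p q => by
    rw [hCv, hmv, Matrix.of_apply]
  have hCvunit : IsUnit Cv.det :=
    hCv ▸ (Matrix.isUnit_iff_isUnit_det _).mp (pcm2im_cov_posDef K C').isUnit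
  obtain ⟨lam, hlam⟩ : ∃ lam : Fin n → ℝ, lam = Cv⁻¹ *ᵥ mv := ⟨_, rfl⟩
  have hCvlam : Cv *ᵥ lam = mv := by
    rw [hlam, Matrix.mulVec_mulVec, Matrix.mul_nonsing_inv _ hCvunit, Matrix.one_mulVec]
  -- `lam ≥ 0`: PCM applied to the rows of `Cv⁻¹`
  have hlam_nonneg : ∀ b, 0 ≤ lam b := by
    intro b
    have hhyp : ∀ z : Fin n, 0 ≤ (Cv⁻¹ * Cv) b z := fun z => by
      rw [Matrix.nonsing_inv_mul _ hCvunit, Matrix.one_apply]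
      split_ifs <;> norm_num
    simp only [Matrix.mul_apply, hCv_apply, hmv] at hhyp
    have h := hPCM n m K C' hK hC'2 (fun w => Cv⁻¹ b w) hhyp
    have h2 : lam b = ∑ w, Cv⁻¹ b w * gksExpect Finset.univ K C' (spinAt w) := by
      rw [hlam, hmv]
      rfl
    rw [h2]
    exact h
  -- `lam y = 0`: the row `y` of `Cv` is `e_y` and `mv y = 0`
  have hmvy : mv y = 0 := hmv ▸ hC' ▸ pcm2im_frozen_mag_y K C y
  have hCvy : ∀ w, Cv y w = if y = w then 1 else 0 := by
    intro w
    rw [hCv_apply, hmvy, zero_mul, sub_zero]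
    by_cases hw : y = w
    · subst hw
      rw [if_pos rfl]
      exact pcm2im_gksExpect_sq K C' y
    · rw [if_neg hw, hC']
      exact pcm2im_frozen_pair_y K C (Ne.symm hw)
  have hlamy : lam y = 0 := by
    have h := congrFun hCvlam y
    simp only [Matrix.mulVec, dotProduct, hCvy, ite_mul, one_mul, zero_mul,
      Finset.sum_ite_eq, Finset.mem_univ, if_true] at h
    rw [h, hmvy]
  -- the second-moment matrix `Σ` of the pair system, read through the frozen system
  obtain ⟨Sg, hSg⟩ : ∃ Sg : Matrix (Fin n) (Fin n) ℝ, Sg = Matrix.of fun p q : Fin n =>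
      gksExpect Finset.univ K C (fun ω => spinAt p ω * spinAt q ω) := ⟨_, rfl⟩
  rw [← hSg]
  have hSgunit : IsUnit Sg.det :=
    hSg ▸ (Matrix.isUnit_iff_isUnit_det _).mp (pcm2im_sigma_posDef K C).isUnit
  have hcol : ∀ z, z ≠ y → Sg z y = mv z := fun z hz => by
    rw [hSg, Matrix.of_apply, hmv, hC']
    exact pcm2im_pair_eq_frozen_mag K C hC hz
  have hrow : ∀ w, w ≠ y → Sg y w = mv w := fun w hw => by
    rw [hSg, Matrix.of_apply, hmv, hC']
    simp_rw [mul_comm (spinAt y _)]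
    exact pcm2im_pair_eq_frozen_mag K C hC hw
  have hblk : ∀ z w, z ≠ y → w ≠ y → Sg z w = Cv z w + mv z * mv w := fun z w hz hw => by
    rw [hCv_apply, hSg, Matrix.of_apply, hC', pcm2im_pair_eq_frozen_pair K C hC hz hw]
    ring
  have hyy : Sg y y = 1 := hSg ▸ pcm2im_gksExpect_sq K C y
  have hg := pcm2im_mulVec_eq_single Sg Cv mv lam y hcol hrow hblk hyy
    (fun z _ => congrFun hCvlam z) hlamy
  rw [pcm2im_inv_entry Sg hSgunit _ y hg x, if_neg hxy]
  exact neg_nonpos.mpr (hlam_nonneg x)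

end Summit.CriticalPhenomena.Ising3DConformalLimit.Cruxes.InverseMFerromagnet.PartialCovarianceLadder
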